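import Summits.ResolutionOfSingularities.ResolutionOfSingularities.Theorems.HomologicalConductorNoZenoStrictTransformCaseA
import Summits.ResolutionOfSingularities.ResolutionOfSingularities.Theorems.HomologicalConductorNoZenoCaseARegular
import Summits.ResolutionOfSingularities.ResolutionOfSingularities.Theorems.HomologicalConductorNoZenoCaseAConstantField
import Literature.AlgebraicGeometry.Resolution.Lipman1969RationalContraction
import HarnessLib

/-!
# Crux `NoZenoR` (stmt-ResolutionOfSingularities-19943), slot 5 (B1) `stub_L1wCoreF3`, seam2 ROUTE M, step (m2):
# REGULAR FIRST-KIND CURVES ARE CONTRACTED by any morphism onto a resolution all of whose curves satisfy (M)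

OURS (cell res-hironaka, crux chain W4.4, lead res-L0-w44-lead-1 gen 9); nothing here is a statement of the manuscript
under review (Hironaka 2017); AI-written, weaker than expert review.  SUPPORT-level, counted 0.  Def-free.  FACTS as explicit
binders (BRICK RULE): `Lipman1969_13_1_d_rat` (F-97 d)), `Lipman1969_15_a` (F-98 a)), and for the minimal-resolution form
`Lipman1969_27_3_rat`.

`S` a two-dimensional normal Noetherian local domain with a RATIONAL singularity; `π : X → Spec S` a resolution; `g : X′ → X`
dominant and birational with `g ≫ π` a resolution; `η′ ∈ excCurvePoints (g ≫ π)` a FIRST-KIND curve (`h⁰(𝒪_{2E′}) = 3·h⁰(E′)`)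
which is REGULAR in the ambient sense (`(𝓘_{E′})_t ⊄ 𝔪_t²` along `E′`; e.g. the exceptional curve of a point blow-up).

* `false_of_firstKind_of_three_mul_h0_lt` — if `g η′ ∈ excCurvePoints π` satisfies (M) `3·h⁰(E) < h⁰(𝒪_{2E})`: FALSE.
  Assembly of the lead's three bricks: `caseA_of_firstKind` (p568621: Case A and `h⁰(E) < h⁰(E′)`),
  `forall_not_stalkIdeal_le_sq_of_caseA` + `forall_isIntegrallyClosed_stalk_ofPoint` (p569618: then `E` is normal),
  `h0_le_h0_of_forall_isIntegrallyClosed_stalk` (p570573: then `h⁰(E′) ≤ h⁰(E)`).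
* `apply_notMem_excCurvePoints_of_firstKind` — if `π` is the MINIMAL resolution then `g η′ ∉ excCurvePoints π`: the node
  curve is contracted to a (closed) point (Lipman (27.3): every curve of the minimal resolution satisfies (M)).

References: J. Lipman, *Rational singularities …*, Publ. Math. IHÉS 36 (1969), Prop. (13.1) d) (p. 223), §15 a) (p. 227),
Thm. (27.1) (p. 275), Cor. (27.3) (p. 277) [`Lipman1969`].
-/

noncomputable section

-- single-problem summit: the doubled namespace component `ResolutionOfSingularities` is forced
set_option linter.dupNamespace false

namespace Summit.ResolutionOfSingularities.ResolutionOfSingularities.Theorems.NoZeno.ExcCount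

open CategoryTheory AlgebraicGeometry TopologicalSpace IsLocalRing
open Literature.AlgebraicGeometry.Resolution Literature.AlgebraicGeometry.Motives
open Literature.AlgebraicGeometry.Motives.RatFn

variable {S : Type} [CommRing S] [IsNoetherianRing S] [IsLocalRing S] [IsDomain S] [IsIntegrallyClosed S]
  {X X' : Scheme.{0}} [IsIntegral X] [IsIntegral X'] [IsLocallyNoetherian X] [IsLocallyNoetherian X']
  {π : X ⟶ Spec (.of S)}

/-- **A regular first-kind curve upstairs is never mapped onto a curve satisfying (M).** [cite: Lipman1969, Corollary (27.3) (p. 277)] -/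
theorem false_of_firstKind_of_three_mul_h0_lt (h131d : Lipman1969_13_1_d_rat.{0}) (h15a : Lipman1969_15_a.{0})
    (hdim : ringKrullDim S = 2) (hS : HasRationalSingularity S)
    (hπ : IsResolution π) (g : X' ⟶ X) [IsDominant g] (hbir : IsBirational g)
    (hψ : IsResolution (g ≫ π)) {η' : X'} (hη : g.base η' ∈ excCurvePoints π)
    (hη' : η' ∈ excCurvePoints (g ≫ π))
    (hM : 3 * h0 π (primeDivisorIdeal (g.base η')) < h0 π (primeDivisorIdeal (g.base η') ^ 2))
    (hfk : h0 (g ≫ π) (primeDivisorIdeal η' ^ 2) = 3 * h0 (g ≫ π) (primeDivisorIdeal η'))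
    (hreg : ∀ t : X', η' ⤳ t → ¬ stalkIdeal (primeDivisorIdeal η') t ≤ (maximalIdeal (X'.presheaf.stalk t)) ^ 2) :
    False := by
  haveI : IsProper π := hπ.isProper
  haveI : IsProper (g ≫ π) := hψ.isProper
  haveI : IsProper g := IsProper.of_comp g π
  -- the two prime divisors are Cartier (regular surfaces, codimension-one points)
  have hcoh : Order.coheight (g.base η') = 1 := IsResolution.coheight_eq_one_of_mem_excCurvePoints hdim hπ hη
  have hF : IsEffectiveCartier (primeDivisorIdeal (g.base η')) :=
    isEffectiveCartier_primeDivisorIdeal_of_isRegular hπ.isRegular hcoh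
  have hF' : IsEffectiveCartier (primeDivisorIdeal η') := isEffectiveCartier_primeDivisorIdeal_of_isRegular
    hψ.isRegular (IsResolution.coheight_eq_one_of_mem_excCurvePoints hdim hψ hη')
  -- Case A and `h⁰(E) < h⁰(E′)`
  obtain ⟨hA, hlt⟩ := caseA_of_firstKind h131d h15a hdim hS hπ g hbir hψ hη hη' rfl hF hF' hM hfk
  -- `E` is regular, hence normal
  have hregE := forall_not_stalkIdeal_le_sq_of_caseA g hF hF' hA hreg
  have hnorm := forall_isIntegrallyClosed_stalk_ofPoint hπ.isRegular hF hregE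
  -- `g♯` is bijective at `η′` (valuation ring downstairs)
  haveI : IsPrincipalIdealRing (X.presheaf.stalk (g.base η')) :=
    isPrincipalIdealRing_stalk_of_coheight_eq_one hπ.isRegular hcoh
  haveI : ValuationRing (X.presheaf.stalk (g.base η')) := inferInstance
  have hbij : Function.Bijective (g.stalkMap η') := stalkMap_bijective_of_isBirational g hbir η'
  -- `h⁰(E′) ≤ h⁰(E)`: contradiction
  have hle := h0_le_h0_of_forall_isIntegrallyClosed_stalk π g η' hbij hnorm
  exact absurd hlt (not_lt.mpr hle)

/-- **Node curves are contracted by the minimal model.**  With `π` the MINIMAL resolution of the rational `S` (so every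
curve of `π` satisfies (M), Lipman (27.3)), a regular first-kind curve `E′` of the resolution `g ≫ π` upstairs maps to a
point which is NOT an exceptional-curve point of `π` (i.e. `g` contracts `E′`). [cite: Lipman1969, Corollary (27.3) (p. 277)] -/
theorem apply_notMem_excCurvePoints_of_firstKind (h273 : Lipman1969_27_3_rat.{0}) (h131d : Lipman1969_13_1_d_rat.{0})
    (h15a : Lipman1969_15_a.{0}) (hdim : ringKrullDim S = 2) (hS : HasRationalSingularity S)
    (hmin : IsMinimalResolution π) (g : X' ⟶ X) [IsDominant g] (hbir : IsBirational g)
    (hψ : IsResolution (g ≫ π)) {η' : X'} (hη' : η' ∈ excCurvePoints (g ≫ π))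
    (hfk : h0 (g ≫ π) (primeDivisorIdeal η' ^ 2) = 3 * h0 (g ≫ π) (primeDivisorIdeal η'))
    (hreg : ∀ t : X', η' ⤳ t → ¬ stalkIdeal (primeDivisorIdeal η') t ≤ (maximalIdeal (X'.presheaf.stalk t)) ^ 2) :
    g.base η' ∉ excCurvePoints π := by
  intro hη
  have hπ : IsResolution π := hmin.1
  have hM := (h273 S hdim hS X π hπ).mp hmin (g.base η') hη
  exact false_of_firstKind_of_three_mul_h0_lt h131d h15a hdim hS hπ g hbir hψ hη hη' hM hfk hreg

end Summit.ResolutionOfSingularities.ResolutionOfSingularities.Theorems.NoZeno.ExcCount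

end
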